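import Summits.ResolutionOfSingularities.ResolutionOfSingularities.Theorems.HilbertSamuelEliminationSigmaMaxModificationsCorridor3WLadderMovingRows
import Summits.ResolutionOfSingularities.ResolutionOfSingularities.Theorems.HilbertSamuelEliminationCampaignW42TertiaryGenuine
import Summits.ResolutionOfSingularities.ResolutionOfSingularities.Theorems.HilbertSamuelEliminationCampaignW42NearChain
import Summits.ResolutionOfSingularities.ResolutionOfSingularities.Theorems.HilbertSamuelEliminationSigmaMaxModificationsCorridor3WLadderDefs
import Literature.AlgebraicGeometry.Resolution.CharPolyhedronOriginChart
import Literature.AlgebraicGeometry.Resolution.AlterationsNormalFormBlowupParts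
import Mathlib.RingTheory.Flat.Basic
import HarnessLib

/-!
# [OURS · L1 W4.2] MODULE `Corridor3WLadderShadowM` (crux chain w42, card C′ v3 MOVING splice) — part 1/2: the DEFINITIONS

PROVENANCE / SPLIT FOR THE GATE (typer res-type-067, res-L1-w42-plan-1 TAKE + TYPING-WANTED 2026-08-27T04:09:15Z item (3), SEAT TABLE
v3.8 05:08:38Z «to res-type-067», hand-over res-type-053 04:57:35Z): the two tree modules `…Corridor3WLadderShadowMDefs` (every `structure` /
`def` of PART 1, in the original order) and `…Corridor3WLadderShadowM` (the PROVED theorems of PART 1: §1 compression, §2 reduction +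
doors, §5 row reductions) land PART 1 («LANDABLE MODULE») of res-L1-w42-idea-1's `HOME/L/res-L1-w42-idea-1/Sketch-L1-idea-1-C3.lean`
(sha16 `ea42ede6917f0ca2`) with every declaration BYTE-IDENTICAL and in the SAME namespace `…Theorems.SigmaMaxModificationsCorridor3.ShadowM`;
PART 2 of that file (namespace `…Cruxes.SigmaMaxModifications.IdeasL1C3`: sorried registered-shape stubs and round-4 tokens) is NOT
landed. Deviations, all gate-forced and content-free: the Defs/proofs split (Theorems files with proofs are capped at 400 lines),
`set_option linter.dupNamespace false` (0-warning rule; same as `…Corridor3WLadderMovingDefs`), and this paragraph.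
`import …Corridor3WLadderShadowM` gives both modules. idea-1's module docstring follows unchanged.

# Sketch-L1-idea-1-C3 — card C′ v3 MOVING SPLICE: the reading-valued shadow law `ShadowLawM` concludes the TREE's moving rows
`Moving.Wtop3PointedM p` / `Moving.Wtop3NonpointedM p` (res-L1-w42-idea-1, IDEATOR 1 · technique A «ridge / polyhedral tertiary
invariant», gen 4, 2026-08-27; CHAIN v3.7 §0f SEAT TABLE «idea-1 successor → C′ v3 MOVING splice (T2) + instance programme (T3)»).

[OURS · L1 W4.2] Crux `SigmaMaxModifications` (stmt-ResolutionOfSingularities-18506), conjunct `SigmaMaxModificationsCorridor3`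
(stmt-…-19249), line of record `w_ladder` v5 MOVING (`HOME/L/w42/w_ladder_v5_moving.lean`, sha16 e55bf4f23146f08b), rows
`stub_Wtop3M_pointed : ∀ p, p.Prime → Moving.Wtop3PointedM p` (THIS FILE is its door) and `stub_Wtop3M_nonpointed` (THE CORE).
The rows are the TREE's (`Theorems/HilbertSamuelEliminationSigmaMaxModificationsCorridor3WLadderMovingDefs.lean`, res-type-053,
namespace `…Theorems.SigmaMaxModificationsCorridor3.Moving`), used BY NAME. NOT a statement of any manuscript; [Hironaka2017] is
never a premise. AI-drafted; AI review is weaker than expert review.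

## PART 1 (LANDABLE as `Theorems/HilbertSamuelEliminationSigmaMaxModificationsCorridor3WLadderShadowM.lean --supports 19249`;
   namespace `…Theorems.SigmaMaxModificationsCorridor3.ShadowM`; 0 sorries; every `theorem` proved, the open content is in `def … : Prop` /
   structure fields)
§1  `exists_strictPlay`, `eventually_const_of_wf` (PROVED; verbatim from C2).
§2  `ShadowLawM p N Q G` (verbatim from C2: readings ∀∃ (M1), well-founded reading-rank (M2), genuine vs waiting steps (M3)) and the
    PROVED reduction `maxOriginNoMovingNearChainAtQ_of_shadowLawM : ShadowLawM p N Q G → Moving.MaxOriginNoMovingNearChainAtQ p N Q G`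
    — the MOVING typing supplies «blown up infinitely often» as DATA of the chain, so C2's liveness hypothesis `QLive`/`WFair` is GONE
    (ruling STARVATION, CHAIN v3.7: v4's `WFair` is false by centre-disjoint starvation; the moving rows are starvation-free).
    `law_waiting` is KEPT: a moving chain still contains waiting steps (the centre misses the marked point at that stage; the point is
    carried isomorphically), and the reading must be transported across them. Doors `wtop3PointedM_of_shadowLawM`,
    `wtop3NonpointedM_of_shadowLawM` conclude the tree's rows LITERALLY.
§3  G3L* (verbatim from C2): `ShadowState`, `IsNearFace/IsNearComp/IsGrade3`, `IsCanonCentreAt`, `shadowMoveT`, `ShadowStepStar`,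
    `G3LStarTerminates` (kit j267068 PART A*: exhaustive, no cycle).
§4  READINGS (verbatim from C2) over the tree's Cossart–Piltant API: `genPoints`, `Presents`, `primeOfComponent`, `faceIdeal`, `Reads`.
§5  `CPrime p Q` (the five named claims K3c-i cover / K3c-ii fidelity / K3-mov+K3a moving law / K3-wait / G3L*), the PROVED packaging
    `shadowLawM_of_cPrime` and the PROVED row reductions `wtop3PointedM_of_cPrime : CPrime p QPointed → Moving.Wtop3PointedM p`,
    `wtop3NonpointedM_of_cPrime`.

## PART 2 (NOT for landing; namespace `…Cruxes.SigmaMaxModifications.IdeasL1C3`)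
§6  the five claims as Props + REGISTERED-SHAPE stubs (`stub_K3_moving`, `stub_K3c_cover`, `stub_K3c_fidelity`, `stub_K3_waiting`,
    `stub_G3LStar`; sorried, each with «why it might fail») and `wtop3PointedM_of_stubs : ∀ p : ℕ, p.Prime → Moving.Wtop3PointedM.{0} p`
    — LITERALLY the signature of `w_ladder` v5's `stub_Wtop3M_pointed` (PROVED from the five stubs; no liveness input any more).
§7  ROUND-4 SCOPE TOKENS (typed): `InsepDirAt` («inseparable directrix», `e < ē`) and `EdimLe4At` (hypersurface point); the PROVED
    three-way split `wtop3M_of_three : Wtop3SepHypM → Wtop3NonHypRecM → Wtop3InsepRecM → (W-top row)` (tree recurrence join ×2) and C′'s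
    door on its HONEST scope `wtop3SepHypM_of_shadowLawM`. `Reads` needs a `κ(x)`-rational Δ-prepared frame `in_𝔪 = Y^m`,
    which exists only where `e_x = ē_x` (and `edim ≤ 4`); at `p = 2` the sub-row `e_x < ē_x = 3` of BOTH W-top rows contains Hironaka–Mizutani origins
    whose first near point leaves `ℙ(Dir_{κ(x)})` (pointed witness: `x₀² + λx₁² + μx₂² + λμx₃² + Σ x_i⁵` over `𝔽₂(λ, μ)`; barrier
    `DirectrixSmallCharacteristic`) — recorded as the honest hole of `stub_K3c_cover` and as a proposed G-split of the W-top rows.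
§8  ROUND-4 BIRTH LAW (typed first lemmas of the K3d frontier, technique A): after a point blow-up of a Δ-minimal grade-3 point the
    near locus on `ℙ(Dir) ≅ ℙ²` is cut out by multiplicity conditions on the initial forms of the coefficients (`BirthNear`); near
    CURVES of degree `γ` need `γ ≤ δ/(2−δ)`, so UNTIDY near-locus germs (≥ 3 branches, tangency, singular branch: degree ≥ 3) need
    `δ(Δ) ≥ 3/2`, and `BirthTidy` (a plane form of degree `d` with `2d < 3μ` vanishing to order `μ` at three non-collinear points is zero;
    sharp: `(U₀U₁U₂)^k`) makes every birth with `δ(Δ) < 6/5` COLLINEAR.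

COSTUME / T1 AUDIT (unchanged from C2). `ShadowLawM` has free fields `St, reads, rk`; the trivial instance (`reads _ _ s st := st = s`,
`rk` := the tree's moving rank) is BLOCKED by `law_waiting` (a waiting step changes the stage but must keep the reading); the content is
the INSTANCE `CPrime` (`St := ShadowState`, `step := ShadowStepStar`, `good := IsGrade3`, `reads := Reads` DEFINED), only `rk` existential.
-/

noncomputable section

open CategoryTheory AlgebraicGeometry TopologicalSpace Topology Polynomial
open Literature.AlgebraicGeometry.Resolution
open Summit.ResolutionOfSingularities.ResolutionOfSingularities.Theorems.CampaignW42

-- 0-warning rule of the gate (the summit namespace `ResolutionOfSingularities.ResolutionOfSingularities` is flagged by the linter)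
set_option linter.dupNamespace false

/-! # PART 1 — LANDABLE MODULE `…Theorems.SigmaMaxModificationsCorridor3.ShadowM` -/

namespace Summit.ResolutionOfSingularities.ResolutionOfSingularities.Theorems.SigmaMaxModificationsCorridor3.ShadowM

universe u

/-! ## §0. The tree's rows, by name -/

open Summit.ResolutionOfSingularities.ResolutionOfSingularities.Theorems.SigmaMaxModificationsCorridor3.Helpers (InScopeCQ QPointed)
open Summit.ResolutionOfSingularities.ResolutionOfSingularities.Theorems.SigmaMaxModificationsCorridor3.Moving
  (MaxOriginNoMovingNearChainAtQ Wtop3PointedM Wtop3NonpointedM)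

/-! ## §2. `ShadowLawM` — reading-valued, well-founded, moving (amendments M1–M3 of R3-9's `ShadowLaw`) -/

/-- [OURS · L1 W4.2] A READING-VALUED SHADOW LAW for grade `G` at level `N` in characteristic `p` from `Q`-origins
(card C′ stagewise; amendments M1–M3 of R3-9's `ShadowLaw`, see the module docstring). NOT a statement of any manuscript.
[folklore] -/
structure ShadowLawM (p N : ℕ) (Q : ℕ → (ℕ → ℕ) → ∀ X : Scheme.{u}, X → Prop) (G : MarkedStage.{u} → Prop) :
    Type (u + 2) where
  /-- shadow states (C′: `ShadowState`) -/
  St : Type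
  /-- the shadow move (C′: `ShadowStepStar`, the extended label game G3L*) -/
  step : St → St → Prop
  /-- good states (C′: grade-3 generating sets) -/
  good : St → Prop
  /-- the reading-rank type and its well-founded strict order (C′/K3a: age-lex vertex data, ω³) -/
  W : Type
  /-- strict descent of ranks -/
  wlt : W → W → Prop
  /-- well-foundedness of the rank order -/
  wf : WellFounded wlt
  /-- rank of a reading -/
  rk : St → W
  /-- ADMISSIBLE READINGS of a marked stage (M1; C′: `Reads` — adapted Δ-prepared presentations with the label dictionary);
  may depend on the oracle and the value (the canonical centre at the stage is part of what a reading must be adapted to) -/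
  reads : (∀ S : Scheme.{u}, CentreSeq S → Prop) → (ℕ → ℕ) → MarkedStage.{u} → St → Prop
  /-- K3c-i COVER: every in-scope `G`-stage admits a reading -/
  cover : ∀ (R : ∀ S : Scheme.{u}, CentreSeq S → Prop), OracleFunctional R → OracleAdmissible R →
    ∀ (ν : ℕ → ℕ) (s : MarkedStage.{u}), InScopeCQ p R N ν Q s → G s → ∃ st, reads R ν s st
  /-- K3c-ii FIDELITY: every reading of an in-scope `G`-stage is good -/
  fidelity : ∀ (R : ∀ S : Scheme.{u}, CentreSeq S → Prop), OracleFunctional R → OracleAdmissible R →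
    ∀ (ν : ℕ → ℕ) (s : MarkedStage.{u}) (st : St), InScopeCQ p R N ν Q s → G s → reads R ν s st → good st
  /-- THE MOVING LAW (∀∃): along a GENUINE canonical near step every reading of `s` has a successor reading of `s'` which is a
  shadow move with non-increasing rank, or a strict rank descent (C′: K3-mov = origin / translated / re-coordinatized moves;
  K3a = the descent at residue-field extensions) -/
  law_moving : ∀ (R : ∀ S : Scheme.{u}, CentreSeq S → Prop), OracleFunctional R → OracleAdmissible R →
    ∀ (ν : ℕ → ℕ) (s s' : MarkedStage.{u}), InScopeCQ p R N ν Q s → G s → G s' →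
      CanonicalNearStep R N ν s s' → s.IsBlownUp R N ν →
      ∀ st, reads R ν s st → ∃ st', reads R ν s' st' ∧ ((step st st' ∧ (wlt (rk st') (rk st) ∨ rk st' = rk st)) ∨ wlt (rk st') (rk st))
  /-- THE WAITING TRANSPORT (M3): along a waiting step every reading of `s` is a reading of `s'` -/
  law_waiting : ∀ (R : ∀ S : Scheme.{u}, CentreSeq S → Prop), OracleFunctional R → OracleAdmissible R →
    ∀ (ν : ℕ → ℕ) (s s' : MarkedStage.{u}), InScopeCQ p R N ν Q s → G s → G s' →
      CanonicalNearStep R N ν s s' → ¬ s.IsBlownUp R N ν → ∀ st, reads R ν s st → reads R ν s' st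
  /-- good shadow plays terminate (C′: `G3LStarTerminates`) -/
  terminates : ∀ f : ℕ → St, good (f 0) → ¬ ∀ n, step (f n) (f (n + 1))

/-! ## §3. THE EXTENDED LABEL GAME G3L* (combinatorics; C's vocabulary verbatim where unchanged) -/

/-- [verbatim, Sketch C] A SHADOW STATE: generating points `a^{(k)}/(m−b_k) ∈ ℚ³_{≥0}` of `Δ(f; y; u)` in an adapted frame,
labels of the coordinate subspaces `V(y, u_F)`, and the stage counter. -/
structure ShadowState where
  /-- generating points of the polyhedron -/
  A : Finset (Fin 3 → ℚ)
  /-- label (year of birth) of the coordinate subspace `V(y, u_F)`, `F ⊆ {0,1,2}` -/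
  lab : Finset (Fin 3) → ℕ
  /-- stage -/
  n : ℕ

/-- [verbatim, Sketch C] `V(y, u_F)` lies in the top locus: `Σ_{j∈F} a_j ≥ 1` on every generating point. -/
def IsNearFace (A : Finset (Fin 3 → ℚ)) (F : Finset (Fin 3)) : Prop :=
  ∀ a ∈ A, (1 : ℚ) ≤ ∑ j ∈ F, a j

/-- [verbatim, Sketch C] a near COMPONENT through the point: an inclusion-minimal near index set. -/
def IsNearComp (A : Finset (Fin 3 → ℚ)) (F : Finset (Fin 3)) : Prop :=
  F.Nonempty ∧ IsNearFace A F ∧ ∀ G : Finset (Fin 3), G ⊂ F → G.Nonempty → ¬ IsNearFace A G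

/-- [verbatim, Sketch C] grade-3 state: nonnegative generating points with `δ(Δ) > 1`. -/
def IsGrade3 (A : Finset (Fin 3 → ℚ)) : Prop :=
  A.Nonempty ∧ (∀ a ∈ A, ∀ j, (0 : ℚ) ≤ a j) ∧ ∀ a ∈ A, (1 : ℚ) < ∑ j, a j

/-- [OURS] CJS's centre rule with the oldest label `l` explicit: `l` is the least label of a near component, and `F*` is the union
of the index sets of the label-`l` components (the intersection of the oldest coordinate subspaces = the first centre of the
oracle's resolution of `Y_l` at the point). -/
def IsCanonCentreAt (s : ShadowState) (l : ℕ) (Fs : Finset (Fin 3)) : Prop :=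
  (∃ F, IsNearComp s.A F ∧ s.lab F = l) ∧ (∀ F, IsNearComp s.A F → l ≤ s.lab F) ∧
    ∀ j : Fin 3, j ∈ Fs ↔ ∃ F, IsNearComp s.A F ∧ s.lab F = l ∧ j ∈ F

/-- [OURS] THE LOCAL MOVE on generating points for the blow-up of `V(y, u_{F*})`, chart `u_i` (`i ∈ F*`), at the rational point
with non-zero coordinates `S ⊆ F* ∖ {i}`: `a_i ↦ |a|_{F*} − 1`, `a_j ↦ 0` (`j ∈ S`), other coordinates unchanged. `S = ∅` is the
ORIGIN move (C's `shadowMove`, CJS (8.5)/(8.7), tree `CossartPiltant.minExponents_of_mul_pow_eq`); `S ≠ ∅` is the TRANSLATED move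
(the translated frame `u'_j − c_j` kills the `j`-exponents: the constant term `c_j^{a_j} ≠ 0` survives in every characteristic). -/
def shadowMoveT (Fs S : Finset (Fin 3)) (i : Fin 3) (a : Fin 3 → ℚ) : Fin 3 → ℚ :=
  fun j => if j = i then (∑ k ∈ Fs, a k) - 1 else if j ∈ S then 0 else a j

open Classical in
/-- [OURS] ONE MOVE OF G3L*: a canonical blow-up read at a RATIONAL near point of chart `u_i` (origin or translated), again of
grade 3, with CJS's label rule `Labelling.next` on coordinate subspaces: `V(y', u'_G)` with `i ∈ G` lies in the exceptional
divisor and its image closure is `V(y, u_{F* ∪ G})`, a component downstairs iff the centre is the unique oldest component and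
`G ⊆ F*` (then it inherits `l`), else it is born this year; `i ∉ G` is a strict transform and keeps its label. -/
def ShadowStepStar (s s' : ShadowState) : Prop :=
  ∃ (l : ℕ) (Fs S : Finset (Fin 3)) (i : Fin 3), IsCanonCentreAt s l Fs ∧ i ∈ Fs ∧ S ⊆ Fs.erase i ∧
    s'.A = s.A.image (shadowMoveT Fs S i) ∧ IsGrade3 s'.A ∧ s'.n = s.n + 1 ∧
    ∀ G : Finset (Fin 3), s'.lab G =
      if i ∈ G then (if (∀ F, IsNearComp s.A F → s.lab F = l → F = Fs) ∧ G ⊆ Fs then l else s.n + 1) else s.lab G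

/-- [OURS · L1 W4.2] **`G3LStarTerminates`** — every G3L* play from a grade-3 state is finite (for ALL label assignments and
stage counters). Evidence: kit j267068 PART A* (variants 0 = origin moves, 1 = + translated moves, 2 = + integer-point
shaving; gen 2 j263959: 12 605 + 77 454 pointed / 28 491 non-pointed starts of the origin-move game, no cycle, longest play 22).
WHY IT MIGHT FAIL: one infinite play (a cycle up to labels/stage) refutes it and C′ with it; the halving model of residue
extensions DOES cycle ({(2/3,1/3,2/3)} ↔ {(1/3,2/3,2/3)}, local test 2026-08-27) — residue extensions are therefore NOT a move
of G3L* but the rank descent K3a. NOT a statement of any manuscript. -/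
def G3LStarTerminates : Prop :=
  ∀ f : ℕ → ShadowState, IsGrade3 (f 0).A → ¬ ∀ n, ShadowStepStar (f n) (f (n + 1))

/-! ## §4. READINGS over the tree's Cossart–Piltant API -/

section Readings

open Literature.AlgebraicGeometry.Resolution.CossartPiltant

variable {R : Type} [CommRing R]

/-- [OURS] The generating points of `Δ(h; u; X) ⊂ ℚ³_{≥0}` for `h = X^m + Σ_{i=1}^{m} h_{m−i} X^{m−i} ∈ R[X]`: the points `a/i`
for `a ∈ 𝐒(h_{m−i})` (tree `CossartPiltant.minExponents`, Prop. 2.1), all `i = 1..m` (dominated points are harmless: every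
predicate of G3L* reads minima over the set). [cite: CossartPiltant2019, Def. 2.3 (arXiv v1 p. 11)] -/
def genPoints (u : Fin 3 → R) (h : R[X]) : Finset (Fin 3 → ℚ) :=
  (Finset.Icc 1 h.natDegree).biUnion fun i =>
    (minExponents u (h.coeff (h.natDegree - i))).image fun a j => (a j : ℚ) / (i : ℚ)

/-- [OURS] A PRESENTATION of the local ring `𝒪_{W,pt}` of a marked stage by `R[X]/(h)`: a flat local homomorphism generating
the maximal ideal with surjective residue map (⇔ an isomorphism of completions; Cohen structure + Weierstrass preparation give
one with `R = k[[u₁,u₂,u₃]]` for a hypersurface singularity of an excellent threefold point — K3c-i's content in general).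
[folklore] -/
def Presents (s : MarkedStage.{u}) (Q : Type) [CommRing Q] [IsLocalRing Q] : Prop :=
  ∃ φ : (s.W.presheaf.stalk s.pt : Type u) →+* Q, IsLocalHom φ ∧ φ.Flat ∧
    Ideal.map φ (IsLocalRing.maximalIdeal _) = IsLocalRing.maximalIdeal Q ∧
    Function.Surjective ((IsLocalRing.residue Q).comp φ)

/-- [OURS] The prime ideal of `𝒪_{W,x}` cut out by an irreducible closed subset `Z ∋ x` (via its generic point). [folklore] -/
def primeOfComponent (W : Scheme.{u}) (x : W) (Z : Set W) (hZ : IsIrreducible Z) (hx : hZ.genericPoint ⤳ x) :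
    Ideal (W.presheaf.stalk x : Type u) :=
  Ideal.comap (W.presheaf.stalkSpecializes hx).hom (IsLocalRing.maximalIdeal _)

/-- [OURS] The coordinate ideal `(X̄, ū_j : j ∈ F)` of `R[X]/(h)`. [folklore] -/
def faceIdeal (u : Fin 3 → R) (h : R[X]) (F : Finset (Fin 3)) : Ideal (R[X] ⧸ Ideal.span {h}) :=
  Ideal.map (Ideal.Quotient.mk (Ideal.span {h})) (Ideal.span (insert X ((fun j => C (u j)) '' (F : Set (Fin 3)))))

/-- [OURS · L1 W4.2] **`Reads R ν s st`** — `st` is an ADMISSIBLE READING of the marked stage `s` at level `3`: there is a regular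
local ring `R` of dimension `3` with r.s.p. `u`, a monic `h ∈ R[X]` with `R[X]/(h)` local presenting `𝒪_{X_n,x_n}` (`Presents`'
clauses inlined), `Δ(h; u; X)` MINIMAL (tree `CossartPiltant.IsMinimal`, Def. 2.4), such that `st.A` is its set of generating
points, and THE LABEL DICTIONARY holds up to a strictly monotone re-indexing `θ` of labels (`θ st.n ≤ year`, all shadow labels of
near components `≤ st.n`, so the shadow's newborn label `st.n + 1` is fresh and youngest — this makes the WAITING TRANSPORT
`K3-wait` consistent: a waiting step advances the year but not the reading): every irreducible component `Z` of `X_n(ν)` through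
`x_n` is cut out at `x_n` by a coordinate face `(X̄, ū_F)` with `L_n(Z) = θ (st.lab F)`, and every near component face arises so.
(Adaptedness to the boundary and to the canonical centre is carried by the labels: the centre is the union of the oldest components.)
NOT a statement of any manuscript. [folklore] -/
def Reads (_R₀ : ∀ S : Scheme.{u}, CentreSeq S → Prop) (ν : ℕ → ℕ) (s : MarkedStage.{u}) (st : ShadowState) : Prop :=
  ∃ (R : Type) (_ : CommRing R) (_ : IsRegularLocalRing R) (u : Fin 3 → R) (h : R[X])
    (_ : IsLocalRing (R[X] ⧸ Ideal.span {h})) (φ : (s.W.presheaf.stalk s.pt : Type u) →+* R[X] ⧸ Ideal.span {h}) (θ : ℕ → ℕ),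
    ringKrullDim R = 3 ∧ Ideal.span (Set.range u) = IsLocalRing.maximalIdeal R ∧ h.Monic ∧
    IsLocalHom φ ∧ φ.Flat ∧ Ideal.map φ (IsLocalRing.maximalIdeal _) = IsLocalRing.maximalIdeal _ ∧
    Function.Surjective ((IsLocalRing.residue _).comp φ) ∧
    IsMinimal u h ∧ st.A = genPoints u h ∧
    StrictMono θ ∧ θ st.n ≤ s.L.year ∧ (∀ F : Finset (Fin 3), IsNearComp st.A F → st.lab F ≤ st.n) ∧
    (∀ Z ∈ componentsIn (Scheme.hsStratum s.W 3 ν), ∀ (hZ : IsIrreducible Z) (hx : hZ.genericPoint ⤳ s.pt), s.pt ∈ Z →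
      ∃ F : Finset (Fin 3), Ideal.map φ (primeOfComponent s.W s.pt Z hZ hx) = faceIdeal u h F ∧ s.L.label Z = θ (st.lab F)) ∧
    (∀ F : Finset (Fin 3), IsNearComp st.A F →
      ∃ Z ∈ componentsIn (Scheme.hsStratum s.W 3 ν), ∃ (hZ : IsIrreducible Z) (hx : hZ.genericPoint ⤳ s.pt),
        Ideal.map φ (primeOfComponent s.W s.pt Z hZ hx) = faceIdeal u h F ∧ s.L.label Z = θ (st.lab F))

end Readings

/-! ## §5. THE C′ INSTANCE as a structure of named claims, and the PROVED packaging -/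

/-- [OURS · L1 W4.2] **THE C′ CLAIMS** for origins of type `Q` (pointed: `QPointed`; the core: `¬QPointed`): a well-founded
reading-rank (K3a's carrier) and the five named statements. NOT a statement of any manuscript. -/
structure CPrime (p : ℕ) (Q : ℕ → (ℕ → ℕ) → ∀ X : Scheme.{u}, X → Prop) : Type 1 where
  /-- K3a CARRIER: the reading-rank (candidate: the age-lex vertex of Δ with the residue-degree bookkeeping of CJS Thm. 14.4) -/
  W : Type
  /-- its strict order -/
  wlt : W → W → Prop
  /-- well-founded -/
  wf : WellFounded wlt
  /-- the rank of a shadow state -/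
  rk : ShadowState → W
  /-- K3c-i COVER: every in-scope grade-3 stage has an admissible reading (Cohen–Weierstrass presentation, Hironaka preparation =
  CP Prop. 2.2, frame adapted to boundary + near components + canonical centre — these are jointly normal crossing because the
  oracle blows up `Y_l` only once it is regular and B-permissible) -/
  cover : ∀ (R : ∀ S : Scheme.{u}, CentreSeq S → Prop), OracleFunctional R → OracleAdmissible R →
    ∀ (ν : ℕ → ℕ) (s : MarkedStage.{u}), InScopeCQ p R 3 ν Q s → 3 ≤ s.geomDirDim → ∃ st, Reads R ν s st
  /-- K3c-ii FIDELITY: readings of grade-3 stages are grade-3 states (`ē = 3 ⇔ in_𝔪 = Y^m ⇔ δ(Δ) > 1` for a minimal Δ; tree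
  `CharPolyhedronDeltaPositive`) -/
  fidelity : ∀ (R : ∀ S : Scheme.{u}, CentreSeq S → Prop), OracleFunctional R → OracleAdmissible R →
    ∀ (ν : ℕ → ℕ) (s : MarkedStage.{u}) (st : ShadowState), InScopeCQ p R 3 ν Q s → 3 ≤ s.geomDirDim →
      Reads R ν s st → IsGrade3 st.A
  /-- K3-mov THE MOVING LAW: a genuine step to a grade-3 point is, on some admissible reading of the new stage, a G3L* move of the
  given reading with non-increasing rank (origin move: CP Prop. 2.6 = tree `minExponents_of_mul_pow_eq` + `isMinimal_map_of_isMinimal`;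
  translated move + re-preparation; K3b: re-coordinatization of a regular non-linear near centre), OR a strict rank descent
  (K3a: the new point has a larger residue field — CJS Thm. 14.4's `β`-drop in `ℝ³`) -/
  law_moving : ∀ (R : ∀ S : Scheme.{u}, CentreSeq S → Prop), OracleFunctional R → OracleAdmissible R →
    ∀ (ν : ℕ → ℕ) (s s' : MarkedStage.{u}), InScopeCQ p R 3 ν Q s → 3 ≤ s.geomDirDim → 3 ≤ s'.geomDirDim →
      CanonicalNearStep R 3 ν s s' → s.IsBlownUp R 3 ν →
      ∀ st, Reads R ν s st → ∃ st', Reads R ν s' st' ∧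
        ((ShadowStepStar st st' ∧ (wlt (rk st') (rk st) ∨ rk st' = rk st)) ∨ wlt (rk st') (rk st))
  /-- K3-wait THE WAITING TRANSPORT: a waiting step is a local isomorphism at the marked point compatible with strata and
  labels, so readings are transported identically -/
  law_waiting : ∀ (R : ∀ S : Scheme.{u}, CentreSeq S → Prop), OracleFunctional R → OracleAdmissible R →
    ∀ (ν : ℕ → ℕ) (s s' : MarkedStage.{u}), InScopeCQ p R 3 ν Q s → 3 ≤ s.geomDirDim → 3 ≤ s'.geomDirDim →
      CanonicalNearStep R 3 ν s s' → ¬ s.IsBlownUp R 3 ν → ∀ st, Reads R ν s st → Reads R ν s' st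
  /-- G3L* terminates -/
  g3lStar : G3LStarTerminates

/-- **PACKAGING (PROVED)**: the C′ claims are a reading-valued shadow law with `St := ShadowState`, `step := ShadowStepStar`,
`good := IsGrade3 ∘ A`, `reads := Reads`. [folklore] -/
def shadowLawM_of_cPrime {p : ℕ} {Q : ℕ → (ℕ → ℕ) → ∀ X : Scheme.{u}, X → Prop} (S : CPrime.{u} p Q) :
    ShadowLawM.{u} p 3 Q fun s => 3 ≤ s.geomDirDim where
  St := ShadowState
  step := ShadowStepStar
  good st := IsGrade3 st.A
  W := S.W
  wlt := S.wlt
  wf := S.wf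
  rk := S.rk
  reads := Reads
  cover := S.cover
  fidelity := S.fidelity
  law_moving := S.law_moving
  law_waiting := S.law_waiting
  terminates := S.g3lStar

end Summit.ResolutionOfSingularities.ResolutionOfSingularities.Theorems.SigmaMaxModificationsCorridor3.ShadowM

end
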